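import Literature.MathematicalPhysics.QuantumLattice.DuhamelTwoPoint
import Literature.MathematicalPhysics.QuantumLattice.OnSitePairingAlgebra
import Literature.MathematicalPhysics.QuantumLattice.FinDimSpectrumSectorGibbsLimit
import Literature.MathematicalPhysics.QuantumLattice.SectorSpectrum

/-!
# Route `JosephsonMirror` — the entropy price of a window Gibbs state

Helper file (`--supports` stmt-HubbardSuperconductivity-2228, crux `JmCusp`) for route `JosephsonMirror`
(sub-problem `HubbardSuperconductivity`), first half of the glue of the crux idea
`thermofield-double-purification` (`Cruxes/JmCusp/Ideas/thermofield-double-purification.md`): the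
Gibbs variational principle RESTRICTED TO A WINDOW.  For a Hermitian `A` and a Hermitian idempotent `Π`
commuting with `A` (a union of invariant coordinate sectors),

* `gibbsWeight_add_smul_idempotent` — `e^{-β(A + κQ)} = e^{-βA} + (e^{-βκ} - 1) e^{-βA} Q` for an idempotent
  `Q` commuting with `A` (the Gibbs weight of `A` pinned off the window by the penalty `κ(1 - Π)`);
* `re_trace_proj_hamiltonian_gibbsWeight_le` — the ENTROPY PRICE:
  `Re tr(Π A e^{-βA}) ≤ (a + log(card)/β) · Re tr(Π e^{-βA})` (`β > 0`) as soon as `a` bounds the Rayleigh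
  quotient of `A` at ONE unit vector of the window; proof: the full-space energy–entropy bound
  `⟨H⟩_β ≤ E_{i₀} + log(dim)/β` (`re_gibbsState_hamiltonian_le`) for `H_κ = A + κ(1 - Π)`, whose ground
  energy is `≤ a`, and `κ → ∞`;
* `re_trace_proj_gibbsWeight_nonneg` — `Re tr(Π e^{-βA}) ≥ 0`;
* `minEnergyOn_mul_self_le` — the homogeneous sector Rayleigh bound `E_K · ‖ψ‖² ≤ Re ⟨ψ, H ψ⟩` on `K`.

Sources: H. Tasaki, *Physics and Mathematics of Quantum Many-Body Systems* (2020), App. A (Gibbs states,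
`⟨H⟩_β → E₀`, the variational characterisation); O. Bratteli, D. W. Robinson, *Operator Algebras and
Quantum Statistical Mechanics II*, §5.3.1.  Folklore matrix analysis; no new definitions.
-/

-- the mandated namespace `Summit.<Summit>.<Problem>.Theorems` repeats `HubbardSuperconductivity`
-- (single-problem summit, D-0017), which the `dupNamespace` linter flags on every declaration
set_option linter.dupNamespace false

namespace Summit.HubbardSuperconductivity.HubbardSuperconductivity.Theorems.JosephsonMirror

open Matrix Literature.MathematicalPhysics.QuantumLattice
open scoped ComplexOrder Matrix.Norms.L2Operator

variable {ι : Type*} [Fintype ι] [DecidableEq ι]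

/-! ### Gibbs weights pinned off a window -/

/-- **`e^{-β(A + κQ)} = e^{-βA} + (e^{-βκ} - 1) · e^{-βA} Q`** for an idempotent `Q` commuting with `A`
(`e^{-βκQ} = 1 + (e^{-βκ} - 1) Q`, `exp_smul_of_isIdempotentElem`). [folklore] -/
theorem gibbsWeight_add_smul_idempotent {A Q : Matrix ι ι ℂ} (hAQ : Commute A Q)
    (hQ : IsIdempotentElem Q) (β κ : ℝ) :
    gibbsWeight β (A + (κ : ℂ) • Q) =
      gibbsWeight β A + ((Real.exp (-(β * κ)) : ℂ) - 1) • (gibbsWeight β A * Q) := by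
  have hsplit : (-(β : ℂ)) • (A + (κ : ℂ) • Q) = (-(β : ℂ)) • A + (-(β * κ : ℝ) : ℂ) • Q := by
    rw [smul_add, smul_smul]
    push_cast
    ring_nf
  have hcomm : Commute ((-(β : ℂ)) • A) ((-(β * κ : ℝ) : ℂ) • Q) :=
    (hAQ.smul_left _).smul_right _
  rw [gibbsWeight, hsplit, Matrix.exp_add_of_commute _ _ hcomm, exp_smul_of_isIdempotentElem hQ,
    mul_add, mul_one, mul_smul_comm, Complex.ofReal_exp, Complex.ofReal_neg]
  rfl

omit [DecidableEq ι] in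
/-- A unit vector forces the index type to be nonempty. [folklore] -/
theorem nonempty_of_dotProduct_eq_one {v : ι → ℂ} (hv : star v ⬝ᵥ v = 1) : Nonempty ι := by
  by_contra h
  rw [not_nonempty_iff] at h
  have : star v ⬝ᵥ v = 0 := by simp [dotProduct]
  rw [this] at hv
  exact zero_ne_one hv

/-- **Entropy price of a window Gibbs state (Gibbs variational principle on `range Π`).**  Let `A` be
Hermitian and `Π` a Hermitian idempotent commuting with `A`; if some unit vector `v = Π v` has
`Re ⟨v, A v⟩ ≤ a`, then for `β > 0`
`Re tr(Π A e^{-βA}) ≤ (a + log(card ι)/β) · Re tr(Π e^{-βA})`,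
i.e. the `Π`-restricted Gibbs average of `A` exceeds the window floor by at most the entropy price
`log(dim)/β`.  Proof: apply the full-space bound `⟨H⟩_β ≤ E_{i₀} + log(dim)/β`
(`re_gibbsState_hamiltonian_le`) to `H_κ = A + κ(1 - Π)`, whose Gibbs weight is
`e^{-βA}Π + e^{-βκ} e^{-βA}(1 - Π)` and whose ground energy is `≤ a`, and let `κ → ∞`.
Tasaki (2020) App. A; Bratteli–Robinson II §5.3.1. [folklore] -/
theorem re_trace_proj_hamiltonian_gibbsWeight_le {A P : Matrix ι ι ℂ} (hA : A.IsHermitian)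
    (hP : P.IsHermitian) (hPP : P * P = P) (hAP : Commute A P) {a : ℝ}
    (hatt : ∃ v : ι → ℂ, P *ᵥ v = v ∧ star v ⬝ᵥ v = 1 ∧ (star v ⬝ᵥ A *ᵥ v).re ≤ a)
    {β : ℝ} (hβ : 0 < β) :
    (P * A * gibbsWeight β A).trace.re ≤
      (a + Real.log (Fintype.card ι) / β) * (P * gibbsWeight β A).trace.re := by
  obtain ⟨v, hPv, hv1, hva⟩ := hatt
  haveI : Nonempty ι := nonempty_of_dotProduct_eq_one hv1
  set g : Matrix ι ι ℂ := gibbsWeight β A with hg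
  set Q : Matrix ι ι ℂ := 1 - P with hQ
  set ℓ : ℝ := Real.log (Fintype.card ι) / β with hℓ
  -- algebra of `P`, `Q = 1 - P`
  have hQQ : IsIdempotentElem Q := by
    change Q * Q = Q
    rw [hQ, sub_mul, one_mul, mul_sub, mul_one, hPP, sub_self, sub_zero]
  have hQv : Q *ᵥ v = 0 := by rw [hQ, sub_mulVec, one_mulVec, hPv, sub_self]
  have hAQ : Commute A Q := (Commute.one_right A).sub_right hAP
  have hgQ : Commute g Q := by
    rw [hg]; unfold gibbsWeight; exact (hAQ.smul_left _).exp_left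
  have hQherm : Q.IsHermitian := isHermitian_one.sub hP
  -- the four real numbers
  set TP : ℝ := (g * P * A).trace.re with hTP
  set ZP : ℝ := (g * P).trace.re with hZP
  set TQ : ℝ := (g * Q * A).trace.re with hTQ
  set ZQ : ℝ := (g * Q).trace.re with hZQ
  have hZQ0 : 0 ≤ ZQ := by
    have hpsd : (Qᴴ * g * Q).PosSemidef :=
      (posDef_gibbsWeight β hA).posSemidef.conjTranspose_mul_mul_same Q
    have h1 : (Qᴴ * g * Q).trace = (g * Q).trace := by
      rw [trace_mul_cycle, hQherm.eq, hQQ.eq, ← hgQ.eq]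
    have h2 := hpsd.trace_nonneg
    rw [h1, Complex.nonneg_iff] at h2
    exact h2.1
  -- splitting of the traces of `g` and `g A` along `P + Q = 1`
  have hsplitZ : (g.trace).re = ZP + ZQ := by
    rw [hZP, hZQ, ← Complex.add_re, ← trace_add, ← mul_add, hQ, add_sub_cancel, mul_one]
  have hsplitT : (g * A).trace.re = TP + TQ := by
    rw [hTP, hTQ, ← Complex.add_re, ← trace_add, ← Matrix.add_mul, ← mul_add, hQ, add_sub_cancel,
      mul_one]
  -- main estimate at level `κ`
  have key : ∀ κ : ℝ, a + ℓ ≤ κ → TP ≤ (a + ℓ) * ZP + Real.exp (-(β * κ)) * |TQ| := by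
    intro κ hκ
    set r : ℝ := Real.exp (-(β * κ)) with hr
    have hr0 : 0 < r := Real.exp_pos _
    set Hκ : Matrix ι ι ℂ := A + (κ : ℂ) • Q with hHκ
    have hHκh : Hκ.IsHermitian := by
      refine hA.add ?_
      rw [IsHermitian, conjTranspose_smul, hQherm.eq, Complex.star_def, Complex.conj_ofReal]
    -- Gibbs weight, partition function and energy trace of `Hκ`
    have hgκ : gibbsWeight β Hκ = g + ((r : ℂ) - 1) • (g * Q) :=
      gibbsWeight_add_smul_idempotent hAQ hQQ β κ
    have hZre : (partitionFn β Hκ).re = ZP + r * ZQ := by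
      rw [partitionFn, hgκ, trace_add, trace_smul, Complex.add_re, hsplitZ, smul_eq_mul]
      have : (((r : ℂ) - 1) * (g * Q).trace).re = (r - 1) * (g * Q).trace.re := by
        rw [← Complex.ofReal_one, ← Complex.ofReal_sub, Complex.re_ofReal_mul]
      rw [this, ← hZQ]
      ring
    have hTre : (gibbsWeight β Hκ * Hκ).trace.re = TP + r * TQ + r * κ * ZQ := by
      have hexp : (g + ((r : ℂ) - 1) • (g * Q)) * (A + (κ : ℂ) • Q) =
          g * A + (κ : ℂ) • (g * Q) + ((r : ℂ) - 1) • (g * Q * A) +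
            (((r : ℂ) - 1) * (κ : ℂ)) • (g * Q) := by
        have hgQQ : g * Q * Q = g * Q := by rw [Matrix.mul_assoc, hQQ.eq]
        simp only [add_mul, mul_add, smul_mul_assoc, mul_smul_comm, hgQQ, smul_add, smul_smul,
          mul_comm (κ : ℂ)]
        abel
      rw [hgκ, hexp, trace_add, trace_add, trace_add, trace_smul, trace_smul, trace_smul,
        Complex.add_re, Complex.add_re, Complex.add_re, hsplitT, smul_eq_mul, smul_eq_mul,
        smul_eq_mul, Complex.re_ofReal_mul]
      have h1 : (((r : ℂ) - 1) * (g * Q * A).trace).re = (r - 1) * (g * Q * A).trace.re := by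
        rw [← Complex.ofReal_one, ← Complex.ofReal_sub, Complex.re_ofReal_mul]
      have h2 : (((r : ℂ) - 1) * (κ : ℂ) * (g * Q).trace).re = (r - 1) * κ * (g * Q).trace.re := by
        rw [← Complex.ofReal_one, ← Complex.ofReal_sub, ← Complex.ofReal_mul, Complex.re_ofReal_mul]
      rw [h1, h2, ← hZQ, ← hTQ]
      ring
    -- the partition function is real and positive
    have hZpos : 0 < (partitionFn β Hκ).re := by
      rw [hHκh.partitionFn_eq_ofReal β, Complex.ofReal_re]
      exact Finset.sum_pos (fun i _ => Real.exp_pos _) Finset.univ_nonempty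
    have hZeq : partitionFn β Hκ = (((partitionFn β Hκ).re : ℝ) : ℂ) := by
      rw [hHκh.partitionFn_eq_ofReal β, Complex.ofReal_re]
    -- an eigenvalue of `Hκ` below `a`
    obtain ⟨i₀, hi₀⟩ := exists_eq_ciInf_of_finite (f := hHκh.eigenvalues)
    have hev : hHκh.eigenvalues i₀ ≤ a := by
      rw [hi₀, ← groundEnergy_eq_iInf_eigenvalues_holds hHκh]
      refine (groundEnergy_le_rayleigh_holds hHκh v hv1).trans ?_
      rw [hHκ, add_mulVec, smul_mulVec, hQv, smul_zero, add_zero]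
      exact hva
    -- the full-space energy–entropy bound for `Hκ`
    have hbound := re_gibbsState_hamiltonian_le hHκh hβ i₀
    rw [gibbsState_apply, hZeq, ← Complex.ofReal_inv, Complex.re_ofReal_mul, hTre] at hbound
    rw [hZre] at hbound hZpos
    have hb2 : TP + r * TQ + r * κ * ZQ ≤ (a + ℓ) * (ZP + r * ZQ) := by
      rw [inv_mul_le_iff₀ hZpos] at hbound
      have := mul_le_mul_of_nonneg_left
        (show hHκh.eigenvalues i₀ + ℓ ≤ a + ℓ by linarith) hZpos.le
      linarith
    have hb3 : r * ((a + ℓ - κ) * ZQ) ≤ 0 :=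
      mul_nonpos_of_nonneg_of_nonpos hr0.le (mul_nonpos_of_nonpos_of_nonneg (by linarith) hZQ0)
    have hb4 : -(r * TQ) ≤ r * |TQ| := by
      rw [← mul_neg]
      exact mul_le_mul_of_nonneg_left (neg_le_abs TQ) hr0.le
    nlinarith [hb2, hb3, hb4]
  -- let `κ → ∞`
  have main : TP ≤ (a + ℓ) * ZP := by
    refine le_of_forall_pos_lt_add fun ε hε => ?_
    set κ : ℝ := max (a + ℓ) 0 + |TQ| / ε / β + 1 with hκ
    have hκ1 : a + ℓ ≤ κ := by
      have : 0 ≤ |TQ| / ε / β := by positivity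
      rw [hκ]; linarith [le_max_left (a + ℓ) 0]
    have hκ0 : 0 ≤ κ := by
      have : 0 ≤ |TQ| / ε / β := by positivity
      rw [hκ]; linarith [le_max_right (a + ℓ) 0]
    have hβκ : |TQ| / ε ≤ β * κ := by
      have h1 : |TQ| / ε / β ≤ κ := by rw [hκ]; linarith [le_max_right (a + ℓ) 0]
      rwa [div_le_iff₀' hβ] at h1
    have hexp : Real.exp (-(β * κ)) * |TQ| < ε := by
      rw [Real.exp_neg]
      have h1 : β * κ + 1 ≤ Real.exp (β * κ) := Real.add_one_le_exp _
      have h2 : 0 < Real.exp (β * κ) := Real.exp_pos _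
      rw [inv_mul_lt_iff₀ h2]
      have h3 : |TQ| ≤ ε * (β * κ) := by rwa [div_le_iff₀' hε] at hβκ
      nlinarith [h3, h1, hε]
    linarith [key κ hκ1, hexp]
  -- back to the stated traces
  have h1 : (P * A * gibbsWeight β A).trace.re = TP := by
    rw [hTP, ← hg, trace_mul_cycle]
  have h2 : (P * gibbsWeight β A).trace.re = ZP := by
    rw [hZP, ← hg, trace_mul_comm]
  rw [h1, h2]
  exact main


/-- The real trace of `Π e^{-βA}` is nonnegative for a Hermitian idempotent `Π` commuting with `A`
(`tr(Π e^{-βA}) = tr(Πᴴ e^{-βA} Π) ≥ 0`). [folklore] -/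
theorem re_trace_proj_gibbsWeight_nonneg {A P : Matrix ι ι ℂ} (hA : A.IsHermitian)
    (hP : P.IsHermitian) (hPP : P * P = P) (hAP : Commute A P) (β : ℝ) :
    0 ≤ (P * gibbsWeight β A).trace.re := by
  have hgP : Commute (gibbsWeight β A) P := by
    unfold gibbsWeight; exact (hAP.smul_left _).exp_left
  have hpsd : (Pᴴ * gibbsWeight β A * P).PosSemidef :=
    (posDef_gibbsWeight β hA).posSemidef.conjTranspose_mul_mul_same P
  have h1 : (Pᴴ * gibbsWeight β A * P).trace = (P * gibbsWeight β A).trace := by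
    rw [trace_mul_cycle, hP.eq, hPP]
  have h2 := hpsd.trace_nonneg
  rw [h1, Complex.nonneg_iff] at h2
  exact h2.1

/-! ### The homogeneous sector Rayleigh bound -/

/-- The sector energy bounds the Rayleigh quotient of EVERY vector of the sector, in the homogeneous
form `E · ‖ψ‖² ≤ Re ⟨ψ, H ψ⟩` (normalise a nonzero `ψ`). Tasaki (2020) §2.1. [folklore] -/
theorem minEnergyOn_mul_self_le {n : Type*} [Fintype n] [DecidableEq n] {H : Matrix n n ℂ}
    (hH : H.IsHermitian) (K : Submodule ℂ (n → ℂ)) {ψ : n → ℂ} (hψ : ψ ∈ K) :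
    H.minEnergyOn K * (star ψ ⬝ᵥ ψ).re ≤ (star ψ ⬝ᵥ H *ᵥ ψ).re := by
  by_cases h0 : ψ = 0
  · simp [h0]
  obtain ⟨c, hc0, hc1⟩ := exists_smul_unit h0
  have h := minEnergyOn_le_rayleigh_of_mem hH K (K.smul_mem c hψ) hc1
  have hcc : star c * c = ((Complex.normSq c : ℝ) : ℂ) := by
    rw [Complex.normSq_eq_conj_mul_self]; rfl
  have hn0 : 0 < Complex.normSq c := Complex.normSq_pos.2 hc0
  rw [star_smul, mulVec_smul, smul_dotProduct, dotProduct_smul, smul_smul, hcc, smul_eq_mul,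
    Complex.re_ofReal_mul] at h
  rw [star_smul, smul_dotProduct, dotProduct_smul, smul_smul, hcc, smul_eq_mul] at hc1
  have h1 : Complex.normSq c * (star ψ ⬝ᵥ ψ).re = 1 := by
    have := congrArg Complex.re hc1
    rwa [Complex.re_ofReal_mul, Complex.one_re] at this
  have hpos : 0 ≤ (star ψ ⬝ᵥ ψ).re := by
    have := dotProduct_star_self_nonneg ψ
    exact (Complex.nonneg_iff.mp this).1
  calc H.minEnergyOn K * (star ψ ⬝ᵥ ψ).re
      ≤ Complex.normSq c * (star ψ ⬝ᵥ H *ᵥ ψ).re * (star ψ ⬝ᵥ ψ).re :=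
        mul_le_mul_of_nonneg_right h hpos
    _ = (star ψ ⬝ᵥ H *ᵥ ψ).re * (Complex.normSq c * (star ψ ⬝ᵥ ψ).re) := by ring
    _ = (star ψ ⬝ᵥ H *ᵥ ψ).re := by rw [h1, mul_one]


/-! ### Registered form -/

/-- **Entropy price of a window Gibbs state** — closed (registered) form of
`re_trace_proj_hamiltonian_gibbsWeight_le`: for Hermitian `A`, a Hermitian idempotent `Π` commuting with
`A`, and a floor `a` attained (up to `≤`) by a unit vector of the window,
`Re tr(Π A e^{-βA}) ≤ (a + log(card)/β) · Re tr(Π e^{-βA})` for `β > 0`.  Tasaki (2020) App. A. [folklore] -/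
theorem windowGibbs_entropyPrice : ∀ {n : Type} [Fintype n] [DecidableEq n] {A P : Matrix n n ℂ}, A.IsHermitian → P.IsHermitian → P * P = P → Commute A P → ∀ (a β : ℝ), (∃ v : n → ℂ, Matrix.mulVec P v = v ∧ star v ⬝ᵥ v = 1 ∧ (star v ⬝ᵥ Matrix.mulVec A v).re ≤ a) → 0 < β → (P * A * Matrix.gibbsWeight β A).trace.re ≤ (a + Real.log (Fintype.card n) / β) * (P * Matrix.gibbsWeight β A).trace.re :=
  fun hA hP hPP hAP _ _ hatt hβ => re_trace_proj_hamiltonian_gibbsWeight_le hA hP hPP hAP hatt hβ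

end Summit.HubbardSuperconductivity.HubbardSuperconductivity.Theorems.JosephsonMirror
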